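import Summits.QuantumFields.BalabanUV.Beta.GAN24.ChargeTowerStep

/-!
# `BalabanUV.Beta.GAN24.CubicPushGaugeLegUnfolding` — binder row G-an2-4 ∕ (CONV-C), the (S) row ∕ (W-γ) one level up, the (ζ) step:
# **THE THREE-LEG UNFOLDING OF A CO-DRESSED CUBIC PUSH AGAINST `n ⊗ dφ`** — for ANY local stencil family `S`, bounded `n`, bounded coarse potential `φ`,
# `Σ'_{(u,x)} Σ_κ Σ_κ₂ n κ u·dzφ κ₂ x·e3OfK Lc G_j S l t u x (inl κ)(inl κ₂) = −cH_j·Σ'_{(y,w)} Σ_f Σ_a (Σ_κ Σ'_u n κ u·G_j (Lc•u) y (inr κ) f)·(vertexOfK G_j Lc S l t) y w f (inl a)·dz(φ∘blk) a w`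
# (G-an2-4 CRUX TEAM (2), seat `b2b-balaban-gan24-formalise-leaf-02` = SUPPLIER side of leaf-06's (C2′)∕`hX` mechanism, gen 61; INTENT [LEAF02-G61-INTENT1], PART 1 of 2)

NOT IN PRINT; OUR BOOKKEEPING ([folklore] Fubini∕Ward bookkeeping BY NAME over road-P2 g41's two-kernel sandwich read-out `ChargeTowerLegs.hasSum_sandwich_readout_two`, its weight
carrier `ChargeTowerStep.comp_comp_weighted`, road-P2 g41's coarse pure-gauge source laws `CoarseGaugeSourceResponse.sum_tsum_coarseGrad_colH ∕ _colM` (= d1-leaf-07's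
`colH_ward_KInvStep_all` and an1's `colM_coDressKBmAt_KInvStep_ward` summed by parts), an4's off-lattice zeros `KInvStep_inr_off`, leaf-06's `KernelLegCharges.summable_prod_of_biLoc`;
0 `def`, 0 cited fact, 0 `def … : Prop`, 0 sorry).
HONEST FRAMING (cell contract, verbatim): «discharging `BetaPertH` makes Bałaban's UV stability UNCONDITIONAL — a real constructive-QFT result; it is NOT the continuum limit and NOT
the Clay problem.»  HONEST DEPENDENCY (verbatim): «continuum YM on T⁴ ⇐ BetaPertH ∧ nine spine estimates (0/9 proved); BetaPertH ⇐ (D1) ∧ (D4) ∧ CAP+tail; G-an2-4 gates asym,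
D1 and NE2/3/4.»

WHY.  leaf-06 g48 B″ `GaugeReadSourcePairingSucc` isolates the one new object of the (γ)-type source pairing one level up,
`X_{j+1}(n, ψ; e) = Σ_l Σ'_t colH G_{j+1}(e) l t·(Σ'_{(u,x)} Σ_κ Σ_κ₂ n κ u·dzψ κ₂ x·e3OfK Lc G_j (SrecAt j) l t u x (inl κ)(inl κ₂))`, and road-P2 g44's `hX`
(`ExplicitSourceFormLambdaShare.moments_sigmaPair_exit_succ_of_columnPairing`) asks for its closed form on ONE explicit periodic `n⋆` and `ψ = 1_{B(y)} ∘ blk Lc`.  By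
`SrecAt_succ` the table `SrecAt j` splits into the cubic (E), border (V-H) and Lagrange (Λ) sectors; leaf-06 g49's ENGINE E31 (kit j178383 ∕ j178588) gives the three sector
laws and their cancellation at Bałaban's pins; leaf-06 g49 (β) `GaugeLegDefectsBlockConstant` typed the border and Lagrange laws PER BACKGROUND FORM.  The missing link from the
`e3OfK` currency of `X_{j+1}` to those laws is the unfolding of the two `G_j`-legs of the push, `e3OfK Lc G_j S l t = −mmRead Lc (G_j ∘ vertexOfK G_j Lc S l t ∘ G_j)`, against
the weights `n` (row leg) and `dφ` (column leg) — THIS FILE, for ANY local stencil family `S` (so it serves all three sectors): the gauge leg is evaluated by the coarse pure-gauge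
source laws (`cH_j·d(φ ∘ blk)` on the field legs of the vertex, `0` on its multiplier legs), the `n`-leg stays an opaque response.  PART 2 `GAN24/BorderSectorSourcePairingSucc`
specialises to `S = vhSAt ρ` and closes the border sector with (β).
* §1 `tsum_eq_tsum_zsmul_of_off` (a series supported on the coarse images is a series over the coarse lattice), `summable_weight_row`, `summable_weight_col` (the weighted coarse
  legs of a decaying kernel: summable and uniformly bounded), **`sum_tsum_col_dz`** (THE GAUGE LEG: for `G_j = coDressKBmAt ρ Lc (KInvStep Lc j)`, bounded `φ`, every `g w`:
  `Σ_κ₂ Σ'_z G_j w (Lc•z) g (inr κ₂)·(dz φ) κ₂ z = [g = inl a]·cH_j·dz (φ ∘ blk Lc) a w`, `cH_j = (stepScale_j·Lc^{d+1})⁻¹`).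
* §2 **`hasSum_prod_gaugeLeg_e3OfK`** — THE THREE-LEG UNFOLDING (statement in the title; every `j`, in-block root).
Asserts NO value of any resolvent column beyond the Ward laws quoted; NOTHING of (C2′) ∕ (W-γ) at levels ≥ 1 ∕ (INV) ∕ (S) discharged; NEVER «G-an2-4 closed» as (CONV-C); NOT D1,
NOT `BetaPertH`, NOT continuum, NOT Clay.  2026-08-23; no existing file touched.
-/

noncomputable section

open Finset
open scoped BigOperators
open Literature.MathematicalPhysics.QuantumFieldTheory
open Literature.MathematicalPhysics.QuantumFieldTheory.Balaban1983to89
open Literature.MathematicalPhysics.QuantumFieldTheory.Balaban1983to89.Beta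
open Literature.Probability.LatticeModels (Torus.proj)
open LatticeForm (quo)
open B12Sec2to5 (l1 l1_nonneg)
open ExpKernelCalculus (Site MKer BiLoc Decays comp Zl Zl_nonneg summable_exp_shift summable_exp_shift' l1_sub_symm)
open OneStepResolventKernel (Fib LocStencil eq_zsmul_quo_of_proj)
open AffineAveraging (Form0 Form1 box toSite unitVec unitVec_apply dz contourSum)
open AveragingContours (blk blk_block off blk_add_off)
open AxialProjector (blk_zsmul)
open RootedKernelReflection (off_zsmul)
open OneStepKernelFamily (KInvStep colH vertexOfK vertexFamily_vertexOfK decays_KInvStep KInvStep_inr_off)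
open SecondOrderResponse (colM)
open BalabanStepJetsSucc (mmRead mmRead_inl_inl)
open BalabanStepJets (locStencil_mono)
open AveragingHessianKernels (packVH_inr_inl packVH_inl_inl)
open AveragingHessianKernelsRooted (vhSAt locStencil_vhSAt)
open AveragingWardStencils (b6UnitVec_eq)
open Summit.QuantumFields.BalabanUV.Beta.AxialDressingRooted (IsCombBondAt coDressKBmAt coDressKBmAt_inr_inr decays_coDressKBmAt one_le_of_neZero)
open Summit.QuantumFields.BalabanUV.Beta.BorderedHessian (stepScale)
open Summit.QuantumFields.BalabanUV.Beta.SpineRooted (e3OfK e3OfK_apply)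
open Summit.QuantumFields.BalabanUV.Beta.GAN24.KernelLegCharges (summable_prod_of_biLoc summable_exp_coarse)
open Summit.QuantumFields.BalabanUV.Beta.GAN24.ResolventLegCharges (summable_exp_coarse' tsum_exp_coarse_le tsum_exp_coarse_le')
open Summit.QuantumFields.BalabanUV.Beta.GAN24.CoarseGaugeSourceResponse (summable_bdd_mul sum_tsum_coarseGrad_colH sum_tsum_coarseGrad_colM)
open Summit.QuantumFields.BalabanUV.Beta.GAN24.ChargeTowerLegs (hasSum_sandwich_readout_two)
open Summit.QuantumFields.BalabanUV.Beta.GAN24.ChargeTowerStep (comp_comp_weighted)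
open Summit.QuantumFields.BalabanUV.Beta.GAN24.CubicPushFaceCharge (vhSAt_inl_inl)

namespace Summit.QuantumFields.BalabanUV.Beta.GAN24.CubicPushGaugeLegUnfolding

variable {d : ℕ}

/-! ## §1 Bookkeeping: coarse supports, weighted coarse legs, the gauge leg -/

/-- [folklore] A series whose terms vanish off the coarse images `L•y₀` is the series over the coarse lattice. -/
theorem tsum_eq_tsum_zsmul_of_off {L : ℕ} (hL : 1 ≤ L) {F : Site (d + 1) → ℝ} (hF : ∀ y, off L y ≠ 0 → F y = 0) :
    ∑' y, F y = ∑' y₀ : Site (d + 1), F ((L : ℤ) • y₀) := by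
  have hinj : Function.Injective fun y₀ : Site (d + 1) => (L : ℤ) • y₀ := by
    intro a b h
    funext i
    have hi := congrFun h i
    simp only [Pi.smul_apply, smul_eq_mul] at hi
    exact mul_left_cancel₀ (by exact_mod_cast (by omega : L ≠ 0)) hi
  symm
  refine hinj.tsum_eq fun y hy => ?_
  by_cases hoff : off L y = 0
  · refine ⟨blk L y, ?_⟩
    have h := blk_add_off hL y
    rw [hoff] at h
    have h0 : toSite (0 : Fin (d + 1) → ℕ) = (0 : Site (d + 1)) := by
      funext i; simp [AffineAveraging.toSite]
    simpa [h0] using h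
  · exact absurd (hF y hoff) hy

/-- [folklore] **A WEIGHTED COARSE ROW LEG OF A DECAYING KERNEL IS SUMMABLE AND UNIFORMLY BOUNDED**: `u ↦ ω u·K (N•u) y a f` for `|ω| ≤ B`. -/
theorem summable_weight_row {N : ℕ} [NeZero N] {K : MKer (d + 1) (Fib d)} {C δ : ℝ} (hK : Decays K C δ) (hδ : 0 < δ)
    {ω : Site (d + 1) → ℝ} {B : ℝ} (hω : ∀ u, |ω u| ≤ B) (y : Site (d + 1)) (a f : Fib d) :
    Summable (fun u : Site (d + 1) => ω u * K ((N : ℤ) • u) y a f) ∧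
      |∑' u : Site (d + 1), ω u * K ((N : ℤ) • u) y a f| ≤ B * C * (Real.exp (δ * ((N : ℝ) * (d + 1))) * Zl (d + 1) δ) := by
  have hN : 1 ≤ N := Nat.one_le_iff_ne_zero.2 (NeZero.ne N)
  have hB : 0 ≤ B := (abs_nonneg _).trans (hω 0)
  have hC : 0 ≤ C := hK.nonneg a
  have hmaj : Summable fun u : Site (d + 1) => B * C * Real.exp (-δ * l1 ((N : ℤ) • u - y)) :=
    (summable_exp_coarse (d := d) hN hδ y).mul_left (B * C)
  have hle : ∀ u, |ω u * K ((N : ℤ) • u) y a f| ≤ B * C * Real.exp (-δ * l1 ((N : ℤ) • u - y)) := fun u => by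
    rw [abs_mul, mul_assoc]
    exact mul_le_mul (hω u) (hK _ _ _ _) (abs_nonneg _) hB
  have hs : Summable (fun u : Site (d + 1) => ω u * K ((N : ℤ) • u) y a f) :=
    Summable.of_norm_bounded hmaj (fun u => by rw [Real.norm_eq_abs]; exact hle u)
  refine ⟨hs, ?_⟩
  calc |∑' u : Site (d + 1), ω u * K ((N : ℤ) • u) y a f| ≤ ∑' u : Site (d + 1), |ω u * K ((N : ℤ) • u) y a f| := by
        have h := norm_tsum_le_tsum_norm hs.norm
        simpa only [Real.norm_eq_abs] using h
    _ ≤ ∑' u : Site (d + 1), B * C * Real.exp (-δ * l1 ((N : ℤ) • u - y)) := hs.abs.tsum_le_tsum hle hmaj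
    _ = B * C * ∑' u : Site (d + 1), Real.exp (-δ * l1 ((N : ℤ) • u - y)) := tsum_mul_left
    _ ≤ B * C * (Real.exp (δ * ((N : ℝ) * (d + 1))) * Zl (d + 1) δ) :=
        mul_le_mul_of_nonneg_left (tsum_exp_coarse_le N hδ y) (mul_nonneg hB hC)

/-- [folklore] **A WEIGHTED COARSE COLUMN LEG OF A DECAYING KERNEL IS SUMMABLE AND UNIFORMLY BOUNDED**: `z ↦ K w (N•z) g b·ω z` for `|ω| ≤ B`. -/
theorem summable_weight_col {N : ℕ} [NeZero N] {K : MKer (d + 1) (Fib d)} {C δ : ℝ} (hK : Decays K C δ) (hδ : 0 < δ)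
    {ω : Site (d + 1) → ℝ} {B : ℝ} (hω : ∀ z, |ω z| ≤ B) (w : Site (d + 1)) (g b : Fib d) :
    Summable (fun z : Site (d + 1) => K w ((N : ℤ) • z) g b * ω z) ∧
      |∑' z : Site (d + 1), K w ((N : ℤ) • z) g b * ω z| ≤ B * C * (Real.exp (δ * ((N : ℝ) * (d + 1))) * Zl (d + 1) δ) := by
  have hN : 1 ≤ N := Nat.one_le_iff_ne_zero.2 (NeZero.ne N)
  have hB : 0 ≤ B := (abs_nonneg _).trans (hω 0)
  have hC : 0 ≤ C := hK.nonneg g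
  have hmaj : Summable fun z : Site (d + 1) => B * C * Real.exp (-δ * l1 (w - (N : ℤ) • z)) :=
    (summable_exp_coarse' (d := d) hN hδ w).mul_left (B * C)
  have hle : ∀ z, |K w ((N : ℤ) • z) g b * ω z| ≤ B * C * Real.exp (-δ * l1 (w - (N : ℤ) • z)) := fun z => by
    rw [abs_mul, mul_comm, mul_assoc]
    exact mul_le_mul (hω z) (hK _ _ _ _) (abs_nonneg _) hB
  have hs : Summable (fun z : Site (d + 1) => K w ((N : ℤ) • z) g b * ω z) :=
    Summable.of_norm_bounded hmaj (fun z => by rw [Real.norm_eq_abs]; exact hle z)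
  refine ⟨hs, ?_⟩
  calc |∑' z : Site (d + 1), K w ((N : ℤ) • z) g b * ω z| ≤ ∑' z : Site (d + 1), |K w ((N : ℤ) • z) g b * ω z| := by
        have h := norm_tsum_le_tsum_norm hs.norm
        simpa only [Real.norm_eq_abs] using h
    _ ≤ ∑' z : Site (d + 1), B * C * Real.exp (-δ * l1 (w - (N : ℤ) • z)) := hs.abs.tsum_le_tsum hle hmaj
    _ = B * C * ∑' z : Site (d + 1), Real.exp (-δ * l1 (w - (N : ℤ) • z)) := tsum_mul_left
    _ ≤ B * C * (Real.exp (δ * ((N : ℝ) * (d + 1))) * Zl (d + 1) δ) :=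
        mul_le_mul_of_nonneg_left (tsum_exp_coarse_le' N hδ w) (mul_nonneg hB hC)

section Step

variable {Lc : ℕ} [NeZero Lc] {r : Fin (d + 1) → ℕ}

/-- NOT IN PRINT; OUR BOOKKEEPING.  **THE GAUGE LEG OF THE CO-DRESSED STEP RESOLVENT** (every `j`, in-block root, bounded coarse potential `φ`, every fine leg `(w, g)`):
`Σ_κ₂ Σ'_z G_j w (Lc•z) g (inr κ₂)·(dz φ) κ₂ z = [g = inl a]·cH_j·dz (φ ∘ blk Lc) a w`, `cH_j = (stepScale_j·Lc^{d+1})⁻¹` — the response to the coarse pure-gauge source `dφ` is the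
fine pure gauge of the block lift on the field legs (road-P2 g41 `sum_tsum_coarseGrad_colH`) and ZERO on the multiplier legs (`sum_tsum_coarseGrad_colM` on the coarse lattice, an4's
`KInvStep_inr_off` off it). -/
theorem sum_tsum_col_dz (hr : r ∈ box (d + 1) Lc) (j : ℕ) {φ : Site (d + 1) → ℝ} {Bφ : ℝ} (hφ : ∀ y, |φ y| ≤ Bφ) (g : Fib d) (w : Site (d + 1)) :
    ∑ κ₂, ∑' z : Site (d + 1), coDressKBmAt (toSite r) Lc (KInvStep (d := d) Lc j) w ((Lc : ℤ) • z) g (Sum.inr κ₂) * dz φ κ₂ z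
      = Sum.elim (fun a : Fin (d + 1) => (stepScale d Lc j * (Lc : ℝ) ^ (d + 1))⁻¹ * dz (fun x => φ (blk Lc x)) a w) (fun _ => (0 : ℝ)) g := by
  rcases g with a | m
  · -- field leg: the entries are the `ℋ`-column entries `colH G_j Lc κ₂ z a w`
    have e : ∀ (κ₂ : Fin (d + 1)) (z : Site (d + 1)),
        coDressKBmAt (toSite r) Lc (KInvStep (d := d) Lc j) w ((Lc : ℤ) • z) (Sum.inl a) (Sum.inr κ₂) * dz φ κ₂ z
          = (φ (z + B6BondElimination.unitVec κ₂) - φ z) * colH (coDressKBmAt (toSite r) Lc (KInvStep (d := d) Lc j)) Lc κ₂ z a w := fun κ₂ z => by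
      rw [b6UnitVec_eq, mul_comm]; rfl
    simp only [e, Sum.elim_inl]
    rw [sum_tsum_coarseGrad_colH hr j φ hφ a w, b6UnitVec_eq]
    rfl
  · simp only [Sum.elim_inr]
    by_cases hw : Torus.proj Lc w = 0
    · have ew : w = ((Lc : ℕ) : ℤ) • quo Lc w := eq_zsmul_quo_of_proj hw
      have e : ∀ (κ₂ : Fin (d + 1)) (z : Site (d + 1)),
          coDressKBmAt (toSite r) Lc (KInvStep (d := d) Lc j) w ((Lc : ℤ) • z) (Sum.inr m) (Sum.inr κ₂) * dz φ κ₂ z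
            = (φ (z + B6BondElimination.unitVec κ₂) - φ z) * colM (coDressKBmAt (toSite r) Lc (KInvStep (d := d) Lc j)) Lc κ₂ z m (quo Lc w) := fun κ₂ z => by
        rw [b6UnitVec_eq, mul_comm]
        conv_lhs => rw [ew]
        rfl
      simp only [e]
      exact sum_tsum_coarseGrad_colM (toSite r) j φ hφ m (quo Lc w)
    · have e : ∀ (κ₂ : Fin (d + 1)) (z : Site (d + 1)),
          coDressKBmAt (toSite r) Lc (KInvStep (d := d) Lc j) w ((Lc : ℤ) • z) (Sum.inr m) (Sum.inr κ₂) * dz φ κ₂ z = 0 := fun κ₂ z => by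
        rw [coDressKBmAt_inr_inr, KInvStep_inr_off j hw m _ _, zero_mul]
      simp only [e, tsum_zero, Finset.sum_const_zero]

/-! ## §2 The three-leg unfolding of a co-dressed cubic push against `n ⊗ dφ` -/

/-- NOT IN PRINT; OUR BOOKKEEPING.  **THE THREE-LEG UNFOLDING** (every `j`, in-block root `ρ = toSite r`, ANY local stencil family `S`, bounded 1-form `n`, bounded coarse potential `φ`;
`G_j = coDressKBmAt ρ Lc (KInvStep Lc j)`, `cH_j = (stepScale_j·Lc^{d+1})⁻¹`): the two `G_j`-legs of the push `e3OfK Lc G_j S l t = −mmRead Lc (G_j ∘ vertexOfK G_j Lc S l t ∘ G_j)`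
read against `n` (row leg) and the coarse pure gauge `dφ` (column leg) unfold to
`HasSum ((u,x) ↦ Σ_κ Σ_κ₂ n κ u·dzφ κ₂ x·e3OfK Lc G_j S l t u x (inl κ)(inl κ₂))
   (−cH_j·Σ'_{(y,w)} Σ_f Σ_a (Σ_κ Σ'_u n κ u·G_j (Lc•u) y (inr κ) f)·(vertexOfK G_j Lc S l t) y w f (inl a)·dz (φ∘blk Lc) a w)`
— the gauge leg lands on the FIELD legs of the vertex as the block pure gauge and contributes nothing on its multiplier legs (§1 `sum_tsum_col_dz`); the `n`-leg stays an
opaque response (its `inl` rows are MINUS the `ℋ`-columns, `CombKernelSheetResponse`; its `inr` rows the multiplier columns on the coarse lattice). -/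
theorem hasSum_prod_gaugeLeg_e3OfK (hr : r ∈ box (d + 1) Lc) (j : ℕ)
    {S : Fin (d + 1) → Site (d + 1) → MKer (d + 1) (Fib d)} {Cs δs : ℝ} (hS : LocStencil S Cs δs) (hδs : 0 < δs)
    (l : Fin (d + 1)) (t : Site (d + 1)) {n : Form1 (d + 1) ℝ} {Bn : ℝ} (hn : ∀ κ u, |n κ u| ≤ Bn)
    {φ : Site (d + 1) → ℝ} {Bφ : ℝ} (hφ : ∀ y, |φ y| ≤ Bφ) :
    HasSum (fun ux : Site (d + 1) × Site (d + 1) => ∑ κ, ∑ κ₂, n κ ux.1 * dz φ κ₂ ux.2 *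
        e3OfK Lc (coDressKBmAt (toSite r) Lc (KInvStep (d := d) Lc j)) S l t ux.1 ux.2 (Sum.inl κ) (Sum.inl κ₂))
      (-((stepScale d Lc j * (Lc : ℝ) ^ (d + 1))⁻¹ *
        ∑' yw : Site (d + 1) × Site (d + 1), ∑ f : Fib d, ∑ a : Fin (d + 1),
          (∑ κ, ∑' u : Site (d + 1), n κ u * coDressKBmAt (toSite r) Lc (KInvStep (d := d) Lc j) ((Lc : ℤ) • u) yw.1 (Sum.inr κ) f)
            * vertexOfK (coDressKBmAt (toSite r) Lc (KInvStep (d := d) Lc j)) Lc S l t yw.1 yw.2 f (Sum.inl a)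
            * dz (fun x => φ (blk Lc x)) a yw.2)) := by
  classical
  have hLc : 1 ≤ Lc := one_le_of_neZero Lc
  set G : MKer (d + 1) (Fib d) := coDressKBmAt (toSite r) Lc (KInvStep (d := d) Lc j) with hGdef
  set cH : ℝ := (stepScale d Lc j * (Lc : ℝ) ^ (d + 1))⁻¹ with hcH
  obtain ⟨δ, C, hδ, -, hK⟩ := decays_KInvStep (d := d) (Lc := Lc) j
  obtain ⟨δG, CG, hδG, hCG, hG⟩ := decays_coDressKBmAt hLc hr (K := KInvStep (d := d) Lc j) ⟨δ, C, hδ, hK.nonneg (Sum.inl 0), hK⟩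
  have hCs : 0 ≤ Cs := (hS 0 0).nonneg (Sum.inl 0)
  set m : ℝ := min δs δG with hm
  have hm0 : 0 < m := lt_min hδs hδG
  have hSm : LocStencil S Cs m := locStencil_mono hS hCs (min_le_left _ _)
  set V : MKer (d + 1) (Fib d) := vertexOfK G Lc S l t with hVdef
  have hV : BiLoc V ((Lc : ℤ) • t) ((Lc : ℤ) • t) ((d + 1 : ℕ) * (CG * Cs * Zl (d + 1) (m / 2))) (m / 2) :=
    vertexFamily_vertexOfK (N := Lc) hG hCG hSm hm0 (min_le_right _ _) l t
  have hBn : 0 ≤ Bn := (abs_nonneg _).trans (hn 0 0)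
  have hBφ : 0 ≤ Bφ := (abs_nonneg _).trans (hφ 0)
  have hdzφ : ∀ κ₂ z, |dz φ κ₂ z| ≤ 2 * Bφ := KKTFluctuationEnergy.abs_dz_le hφ
  -- the opaque leg charges
  set ρL : Fin (d + 1) → Fib d → Site (d + 1) → ℝ := fun κ f y => ∑' u : Site (d + 1), n κ u * G ((Lc : ℤ) • u) y (Sum.inr κ) f with hρL
  set ρR : Fin (d + 1) → Fib d → Site (d + 1) → ℝ := fun κ₂ g w => ∑' z : Site (d + 1), G w ((Lc : ℤ) • z) g (Sum.inr κ₂) * dz φ κ₂ z with hρR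
  set T : ℝ := Real.exp (δG * ((Lc : ℝ) * (d + 1))) * Zl (d + 1) δG with hT
  have hρLb : ∀ κ f y, |ρL κ f y| ≤ Bn * CG * T := fun κ f y =>
    (summable_weight_row (N := Lc) hG hδG (ω := n κ) (fun u => hn κ u) y (Sum.inr κ) f).2
  have hρRb : ∀ κ₂ g w, |ρR κ₂ g w| ≤ (2 * Bφ) * CG * T := fun κ₂ g w =>
    (summable_weight_col (N := Lc) hG hδG (ω := dz φ κ₂) (fun z => hdzφ κ₂ z) w g (Sum.inr κ₂)).2
  -- per pair `(κ, κ₂)`: the two-kernel sandwich with the weights folded into the kernels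
  have hpair : ∀ κ κ₂ : Fin (d + 1), HasSum (fun ux : Site (d + 1) × Site (d + 1) =>
      n κ ux.1 * dz φ κ₂ ux.2 * comp (comp G V) G ((Lc : ℤ) • ux.1) ((Lc : ℤ) • ux.2) (Sum.inr κ) (Sum.inr κ₂))
      (∑' yw : Site (d + 1) × Site (d + 1), ∑ f, ∑ g, ρL κ f yw.1 * V yw.1 yw.2 f g * ρR κ₂ g yw.2) := by
    intro κ κ₂
    set K₁ : MKer (d + 1) (Fib d) := fun p q e f => n κ (blk Lc p) * G p q e f with hK₁def
    set K₂ : MKer (d + 1) (Fib d) := fun p q e f => G p q e f * dz φ κ₂ (blk Lc q) with hK₂def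
    have hK₁ : Decays K₁ (Bn * CG) δG := fun p q e f => by
      simp only [hK₁def]
      rw [abs_mul, mul_assoc]
      exact mul_le_mul (hn κ _) (hG p q e f) (abs_nonneg _) hBn
    have hK₂ : Decays K₂ ((2 * Bφ) * CG) δG := fun p q e f => by
      simp only [hK₂def]
      rw [abs_mul, mul_comm, mul_assoc]
      exact mul_le_mul (hdzφ κ₂ _) (hG p q e f) (abs_nonneg _) (by positivity)
    have hrow : ∀ (f : Fib d) (y : Site (d + 1)), HasSum (fun x' : Site (d + 1) => K₁ ((Lc : ℤ) • x') y (Sum.inr κ) f) (ρL κ f y) := by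
      intro f y
      have hs := (summable_weight_row (N := Lc) hG hδG (ω := n κ) (fun u => hn κ u) y (Sum.inr κ) f).1
      refine hs.hasSum.congr_fun fun x' => ?_
      simp only [hK₁def, blk_zsmul hLc, hGdef]
    have hcol : ∀ (g : Fib d) (w : Site (d + 1)), HasSum (fun z' : Site (d + 1) => K₂ w ((Lc : ℤ) • z') g (Sum.inr κ₂)) (ρR κ₂ g w) := by
      intro g w
      have hs := (summable_weight_col (N := Lc) hG hδG (ω := dz φ κ₂) (fun z => hdzφ κ₂ z) w g (Sum.inr κ₂)).1
      refine hs.hasSum.congr_fun fun z' => ?_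
      simp only [hK₂def, blk_zsmul hLc, hGdef]
    have h := hasSum_sandwich_readout_two (N := Lc) hK₁ hK₂ hδG hV (half_pos hm0) κ κ₂ hrow hcol
    refine h.congr_fun fun ux => ?_
    rw [hK₁def, hK₂def, comp_comp_weighted, blk_zsmul hLc, blk_zsmul hLc]
  -- summability of every pair family on the product
  have hΦs : ∀ κ κ₂ : Fin (d + 1), Summable fun yw : Site (d + 1) × Site (d + 1) =>
      ∑ f, ∑ g, ρL κ f yw.1 * V yw.1 yw.2 f g * ρR κ₂ g yw.2 := by
    intro κ κ₂
    refine summable_sum fun f _ => summable_sum fun g _ => ?_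
    have hw : ∀ yw : Site (d + 1) × Site (d + 1), |ρL κ f yw.1 * ρR κ₂ g yw.2| ≤ (Bn * CG * T) * ((2 * Bφ) * CG * T) := fun yw => by
      rw [abs_mul]
      exact mul_le_mul (hρLb κ f yw.1) (hρRb κ₂ g yw.2) (abs_nonneg _) ((abs_nonneg _).trans (hρLb κ f yw.1))
    exact (summable_bdd_mul (summable_prod_of_biLoc hV (half_pos hm0) f g) hw).congr fun yw => by ring
  -- sum the pairs
  have hsum : HasSum (fun ux : Site (d + 1) × Site (d + 1) => ∑ κ, ∑ κ₂,
      n κ ux.1 * dz φ κ₂ ux.2 * comp (comp G V) G ((Lc : ℤ) • ux.1) ((Lc : ℤ) • ux.2) (Sum.inr κ) (Sum.inr κ₂))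
      (∑ κ, ∑ κ₂, ∑' yw : Site (d + 1) × Site (d + 1), ∑ f, ∑ g, ρL κ f yw.1 * V yw.1 yw.2 f g * ρR κ₂ g yw.2) :=
    hasSum_sum fun κ _ => hasSum_sum fun κ₂ _ => hpair κ κ₂
  -- the value: merge the pairs, evaluate the gauge leg
  have hval : (∑ κ, ∑ κ₂, ∑' yw : Site (d + 1) × Site (d + 1), ∑ f, ∑ g, ρL κ f yw.1 * V yw.1 yw.2 f g * ρR κ₂ g yw.2)
      = cH * ∑' yw : Site (d + 1) × Site (d + 1), ∑ f : Fib d, ∑ a : Fin (d + 1),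
          (∑ κ, ρL κ f yw.1) * V yw.1 yw.2 f (Sum.inl a) * dz (fun x => φ (blk Lc x)) a yw.2 := by
    have em : ∀ κ, (∑ κ₂, ∑' yw : Site (d + 1) × Site (d + 1), ∑ f, ∑ g, ρL κ f yw.1 * V yw.1 yw.2 f g * ρR κ₂ g yw.2)
        = ∑' yw : Site (d + 1) × Site (d + 1), ∑ κ₂, ∑ f, ∑ g, ρL κ f yw.1 * V yw.1 yw.2 f g * ρR κ₂ g yw.2 :=
      fun κ => (Summable.tsum_finsetSum (fun κ₂ _ => hΦs κ κ₂)).symm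
    rw [Finset.sum_congr rfl (fun κ _ => em κ), ← Summable.tsum_finsetSum (fun κ _ => summable_sum fun κ₂ _ => hΦs κ κ₂), ← tsum_mul_left]
    refine tsum_congr fun yw => ?_
    -- pointwise: regroup the finite sums and evaluate `Σ_κ₂ ρR κ₂ g w`
    have hR : ∀ g, ∑ κ₂, ρR κ₂ g yw.2 = Sum.elim (fun a : Fin (d + 1) => cH * dz (fun x => φ (blk Lc x)) a yw.2) (fun _ => (0 : ℝ)) g :=
      fun g => sum_tsum_col_dz hr j hφ g yw.2
    calc (∑ κ, ∑ κ₂, ∑ f, ∑ g, ρL κ f yw.1 * V yw.1 yw.2 f g * ρR κ₂ g yw.2)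
        = ∑ f, ∑ g, ∑ κ, ∑ κ₂, ρL κ f yw.1 * V yw.1 yw.2 f g * ρR κ₂ g yw.2 := by
          -- reorder (κ, κ₂, f, g) → (f, g, κ, κ₂)
          have s1 : (∑ κ, ∑ κ₂, ∑ f, ∑ g, ρL κ f yw.1 * V yw.1 yw.2 f g * ρR κ₂ g yw.2)
              = ∑ κ, ∑ f, ∑ κ₂, ∑ g, ρL κ f yw.1 * V yw.1 yw.2 f g * ρR κ₂ g yw.2 :=
            Finset.sum_congr rfl fun κ _ => Finset.sum_comm
          have s2 : (∑ κ, ∑ f, ∑ κ₂, ∑ g, ρL κ f yw.1 * V yw.1 yw.2 f g * ρR κ₂ g yw.2)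
              = ∑ f, ∑ κ, ∑ κ₂, ∑ g, ρL κ f yw.1 * V yw.1 yw.2 f g * ρR κ₂ g yw.2 := Finset.sum_comm
          have s3 : ∀ f κ, (∑ κ₂, ∑ g, ρL κ f yw.1 * V yw.1 yw.2 f g * ρR κ₂ g yw.2)
              = ∑ g, ∑ κ₂, ρL κ f yw.1 * V yw.1 yw.2 f g * ρR κ₂ g yw.2 := fun f κ => Finset.sum_comm
          have s4 : ∀ f, (∑ κ, ∑ g, ∑ κ₂, ρL κ f yw.1 * V yw.1 yw.2 f g * ρR κ₂ g yw.2)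
              = ∑ g, ∑ κ, ∑ κ₂, ρL κ f yw.1 * V yw.1 yw.2 f g * ρR κ₂ g yw.2 := fun f => Finset.sum_comm
          rw [s1, s2]
          refine Finset.sum_congr rfl fun f _ => ?_
          rw [Finset.sum_congr rfl (fun κ _ => s3 f κ), s4 f]
      _ = ∑ f, ∑ g, (∑ κ, ρL κ f yw.1) * V yw.1 yw.2 f g * (∑ κ₂, ρR κ₂ g yw.2) := by
          refine Finset.sum_congr rfl fun f _ => Finset.sum_congr rfl fun g _ => ?_
          rw [Finset.mul_sum]
          simp_rw [Finset.sum_mul]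
          exact Finset.sum_comm
      _ = ∑ f, ∑ a : Fin (d + 1), (∑ κ, ρL κ f yw.1) * V yw.1 yw.2 f (Sum.inl a) * (cH * dz (fun x => φ (blk Lc x)) a yw.2) := by
          refine Finset.sum_congr rfl fun f _ => ?_
          rw [Fintype.sum_sum_type]
          simp only [hR, Sum.elim_inl, Sum.elim_inr, mul_zero, Finset.sum_const_zero, add_zero]
      _ = cH * ∑ f, ∑ a : Fin (d + 1), (∑ κ, ρL κ f yw.1) * V yw.1 yw.2 f (Sum.inl a) * dz (fun x => φ (blk Lc x)) a yw.2 := by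
          rw [Finset.mul_sum]
          refine Finset.sum_congr rfl fun f _ => ?_
          rw [Finset.mul_sum]
          exact Finset.sum_congr rfl fun a _ => by ring
  rw [hval] at hsum
  refine hsum.neg.congr_fun fun ux => ?_
  rw [← Finset.sum_neg_distrib]
  refine Finset.sum_congr rfl fun κ _ => ?_
  rw [← Finset.sum_neg_distrib]
  refine Finset.sum_congr rfl fun κ₂ _ => ?_
  rw [e3OfK_apply, mmRead_inl_inl]
  ring

end Step

end Summit.QuantumFields.BalabanUV.Beta.GAN24.CubicPushGaugeLegUnfolding

end
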